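import Summits.Ventures.HodgeRepro2.T5BorelHyperbolic
import Summits.Ventures.HodgeRepro2.T5BorelWittOne

/-!
# T5UnipotentRadical — the unipotent radicals of the rank-one Borels are the unipotent elements

Tier-5 support for sub-step N3, row T2 / the Lemma (D_σ)-cusp of route/T5-SUPPORT-p3.md §14
(prose item §15(c)(i): «their unipotent radicals in MVW's sense are the N above»).

Files 23–26 of seat p3 pin, inside the line stabilisers `B = borel E ≤ U(ℍ)` and
`B_a = borelJ a ≤ U(J_a)`, the normal subgroups `N = ker (B → T)` (the `u(x)`) and
`N_a = ker (B_a → T × U(1))` (the Heisenberg elements `n(y, z)`) and prove `N = [B, B]`.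
This file adds the LITERAL reading of «unipotent radical»: with `IsUnipotent₂ M := (M - 1) ^ 2 = 0`
and `IsUnipotent₃ M := (M - 1) ^ 3 = 0` (a matrix is unipotent when `M - 1` is nilpotent),

* `mem_ker_torusHom_iff_isUnipotent` : `g ∈ N ↔ IsUnipotent₂ (mat g)` for `g ∈ B`;
* `mem_ker_leviHom_iff_isUnipotent` : `g ∈ N_a ↔ IsUnipotent₃ (mat g)` for `g ∈ B_a`;

so `N`, `N_a` are exactly the unipotent elements of the Borels — the unipotent radical in the
textbook sense (the normal subgroup of all unipotent elements of a connected solvable group) —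
over every field `E` with a star (no characteristic restriction).  Two small companions:
unipotency is invariant under conjugation (`isUnipotent₂_conj`, `isUnipotent₃_conj`), so the
unipotent radicals of the conjugate line stabilisers of file 27 correspond, and `B ⧸ N` is the
torus `T = torusHom.range` (`borelQuotUnipotentEquiv`), `B_a ⧸ N_a` the Levi (`borelJQuotHeisEquiv`).

Everything is proved (0 sorries); axioms ⊆ {propext, Classical.choice, Quot.sound}.
KEY-HYGIENE (README §8(d)): uses an L-value-free non-vanishing device: NO.
-/

namespace Summit.Ventures.HodgeRepro2.T5UnipotentRadical

open T5UnipotentCommutator T5BorelHyperbolic T5HeisenbergCommutator T5BorelWittOne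

/-! ## 1. Unipotent matrices of size two and three -/

section Matrices

variable {E : Type*} [Field E]

/-- A `2 × 2` matrix is unipotent when `M - 1` squares to zero. -/
def IsUnipotent₂ (M : Matrix (Fin 2) (Fin 2) E) : Prop := (M - 1) ^ 2 = 0

/-- A `3 × 3` matrix is unipotent when `M - 1` cubes to zero. -/
def IsUnipotent₃ (M : Matrix (Fin 3) (Fin 3) E) : Prop := (M - 1) ^ 3 = 0

/-- `!![a, b; 0, d] - 1 = !![a - 1, b; 0, d - 1]`. -/
theorem upper_two_sub_one (a b d : E) :
    (!![a, b; 0, d] : Matrix (Fin 2) (Fin 2) E) - 1 = !![a - 1, b; 0, d - 1] := by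
  ext i j
  fin_cases i <;> fin_cases j <;> simp

/-- An upper triangular `2 × 2` matrix is unipotent iff both diagonal entries are `1`. -/
theorem isUnipotent₂_upper_iff (a b d : E) :
    IsUnipotent₂ (!![a, b; 0, d] : Matrix (Fin 2) (Fin 2) E) ↔ a = 1 ∧ d = 1 := by
  unfold IsUnipotent₂
  rw [upper_two_sub_one, sq, Matrix.mul_fin_two]
  constructor
  · intro h
    have h00 := congrFun (congrFun h 0) 0
    have h11 := congrFun (congrFun h 1) 1
    simp only [mul_zero, add_zero, zero_mul, zero_add, Fin.isValue, Matrix.of_apply,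
      Matrix.cons_val', Matrix.cons_val_zero, Matrix.cons_val_fin_one, Matrix.zero_apply,
      mul_eq_zero, or_self, Matrix.cons_val_one] at h00 h11
    exact ⟨sub_eq_zero.mp h00, sub_eq_zero.mp h11⟩
  · rintro ⟨rfl, rfl⟩
    ext i j
    fin_cases i <;> fin_cases j <;> simp

/-- `!![α, p, q; 0, β, r; 0, 0, δ] - 1 = !![α - 1, p, q; 0, β - 1, r; 0, 0, δ - 1]`. -/
theorem upper_three_sub_one (α p q β r δ : E) :
    (!![α, p, q; 0, β, r; 0, 0, δ] : Matrix (Fin 3) (Fin 3) E) - 1 =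
      !![α - 1, p, q; 0, β - 1, r; 0, 0, δ - 1] := by
  ext i j
  fin_cases i <;> fin_cases j <;> simp

/-- The diagonal of the cube of an upper triangular `3 × 3` matrix is the cube of the diagonal. -/
theorem upper_three_pow_three_diag (x p q y r z : E) :
    ((!![x, p, q; 0, y, r; 0, 0, z] : Matrix (Fin 3) (Fin 3) E) ^ 3) 0 0 = x ^ 3 ∧
    ((!![x, p, q; 0, y, r; 0, 0, z] : Matrix (Fin 3) (Fin 3) E) ^ 3) 1 1 = y ^ 3 ∧
    ((!![x, p, q; 0, y, r; 0, 0, z] : Matrix (Fin 3) (Fin 3) E) ^ 3) 2 2 = z ^ 3 := by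
  rw [pow_succ, sq, Matrix.mul_fin_three, Matrix.mul_fin_three]
  refine ⟨?_, ?_, ?_⟩ <;> simp <;> ring

/-- A strictly upper triangular `3 × 3` matrix cubes to zero. -/
theorem strictUpper_three_pow_three (p q r : E) :
    (!![0, p, q; 0, 0, r; 0, 0, 0] : Matrix (Fin 3) (Fin 3) E) ^ 3 = 0 := by
  rw [pow_succ, sq, Matrix.mul_fin_three, Matrix.mul_fin_three]
  ext i j
  fin_cases i <;> fin_cases j <;> simp

/-- An upper triangular `3 × 3` matrix is unipotent iff its three diagonal entries are `1`. -/
theorem isUnipotent₃_upper_iff (α p q β r δ : E) :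
    IsUnipotent₃ (!![α, p, q; 0, β, r; 0, 0, δ] : Matrix (Fin 3) (Fin 3) E) ↔
      α = 1 ∧ β = 1 ∧ δ = 1 := by
  unfold IsUnipotent₃
  rw [upper_three_sub_one]
  constructor
  · intro h
    obtain ⟨h00, h11, h22⟩ := upper_three_pow_three_diag (α - 1) p q (β - 1) r (δ - 1)
    rw [h] at h00 h11 h22
    simp only [Matrix.zero_apply] at h00 h11 h22
    exact ⟨sub_eq_zero.mp (pow_eq_zero_iff three_ne_zero |>.mp h00.symm),
      sub_eq_zero.mp (pow_eq_zero_iff three_ne_zero |>.mp h11.symm),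
      sub_eq_zero.mp (pow_eq_zero_iff three_ne_zero |>.mp h22.symm)⟩
  · rintro ⟨rfl, rfl, rfl⟩
    rw [sub_self]
    exact strictUpper_three_pow_three p q r

/-! ## 2. Conjugation invariance -/

/-- `(g M g⁻¹ - 1) ^ n = g (M - 1) ^ n g⁻¹` for an invertible `g` (any square size). -/
theorem conj_sub_one_pow {n : Type*} [Fintype n] [DecidableEq n] (g : GL n E)
    (M : Matrix n n E) (k : ℕ) :
    ((g : Matrix n n E) * M * ((g⁻¹ : GL n E) : Matrix n n E) - 1) ^ k =
      (g : Matrix n n E) * (M - 1) ^ k * ((g⁻¹ : GL n E) : Matrix n n E) := by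
  have h1 : (g : Matrix n n E) * M * ((g⁻¹ : GL n E) : Matrix n n E) - 1 =
      (g : Matrix n n E) * (M - 1) * ((g⁻¹ : GL n E) : Matrix n n E) := by
    rw [Matrix.mul_sub, Matrix.sub_mul, Matrix.mul_one]
    congr 1
    exact (Units.mul_inv g).symm
  rw [h1]
  induction k with
  | zero => simp
  | succ k ih =>
    rw [pow_succ, ih, pow_succ]
    calc (g : Matrix n n E) * (M - 1) ^ k * ((g⁻¹ : GL n E) : Matrix n n E) *
          ((g : Matrix n n E) * (M - 1) * ((g⁻¹ : GL n E) : Matrix n n E))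
        = (g : Matrix n n E) * (M - 1) ^ k * (((g⁻¹ : GL n E) : Matrix n n E) * g) *
            (M - 1) * ((g⁻¹ : GL n E) : Matrix n n E) := by simp only [Matrix.mul_assoc]
      _ = (g : Matrix n n E) * ((M - 1) ^ k * (M - 1)) * ((g⁻¹ : GL n E) : Matrix n n E) := by
          rw [Units.inv_mul, Matrix.mul_one]; simp only [Matrix.mul_assoc]

/-- Unipotency of `2 × 2` matrices is invariant under conjugation by `GL₂`. -/
theorem isUnipotent₂_conj (g : GL (Fin 2) E) (M : Matrix (Fin 2) (Fin 2) E) :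
    IsUnipotent₂ ((g : Matrix (Fin 2) (Fin 2) E) * M * ((g⁻¹ : GL (Fin 2) E) : Matrix (Fin 2) (Fin 2) E)) ↔
      IsUnipotent₂ M := by
  unfold IsUnipotent₂
  rw [conj_sub_one_pow]
  constructor
  · intro h
    have := congrArg (fun X => ((g⁻¹ : GL (Fin 2) E) : Matrix (Fin 2) (Fin 2) E) * X * g) h
    simpa [Matrix.mul_assoc, Units.inv_mul, Units.mul_inv] using this
  · intro h; rw [h]; simp

/-- Unipotency of `3 × 3` matrices is invariant under conjugation by `GL₃`. -/
theorem isUnipotent₃_conj (g : GL (Fin 3) E) (M : Matrix (Fin 3) (Fin 3) E) :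
    IsUnipotent₃ ((g : Matrix (Fin 3) (Fin 3) E) * M * ((g⁻¹ : GL (Fin 3) E) : Matrix (Fin 3) (Fin 3) E)) ↔
      IsUnipotent₃ M := by
  unfold IsUnipotent₃
  rw [conj_sub_one_pow]
  constructor
  · intro h
    have := congrArg (fun X => ((g⁻¹ : GL (Fin 3) E) : Matrix (Fin 3) (Fin 3) E) * X * g) h
    simpa [Matrix.mul_assoc, Units.inv_mul, Units.mul_inv] using this
  · intro h; rw [h]; simp

end Matrices

section Unitary

variable {E : Type*} [Field E] [StarRing E]

/-! ## 3. The unipotent radical of `B ≤ U(ℍ)` is `N = ker torusHom` -/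

/-- For `g ∈ B`: `g ∈ N ↔ g₀₀ = 1` (the torus character is the `(0,0)` entry). -/
theorem mem_ker_torusHom_iff_entry (g : borel E) :
    g ∈ torusHom.ker ↔ entry (g : hypUnitary E) 0 0 = 1 := by
  rw [MonoidHom.mem_ker]
  constructor
  · intro h
    have := torusHom_apply g
    rw [h] at this
    simpa using this.symm
  · intro h
    apply Units.ext
    rw [torusHom_apply, h]
    rfl

/-- For `g ∈ B`, the `(0,0)` entry is `1` iff the `(1,1)` entry is `1` (the relation `ā d = 1`). -/
theorem entry_00_eq_one_iff (g : hypUnitary E) (hg : entry g 1 0 = 0) :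
    entry g 0 0 = 1 ↔ entry g 1 1 = 1 := by
  have hrel := (upper_relations g hg).1
  constructor
  · intro h; rw [h, star_one, one_mul] at hrel; exact hrel
  · intro h
    rw [h, mul_one] at hrel
    have : star (star (entry g 0 0)) = star (1 : E) := by rw [hrel]
    simpa using this

/-- **The unipotent radical of `B = borel E`**: an element of the Borel lies in
`N = ker torusHom` (the subgroup of the `u(x)`, `x̄ = -x`, files 23/25) iff its matrix is
unipotent. -/
theorem mem_ker_torusHom_iff_isUnipotent (g : borel E) :
    g ∈ torusHom.ker ↔ IsUnipotent₂ (mat ((g : hypUnitary E) : GL (Fin 2) E)) := by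
  have hg : entry (g : hypUnitary E) 1 0 = 0 := (mem_borel_iff _).mp g.2
  rw [mem_ker_torusHom_iff_entry, mat_eq_upper _ hg, isUnipotent₂_upper_iff]
  constructor
  · intro h; exact ⟨h, (entry_00_eq_one_iff _ hg).mp h⟩
  · intro h; exact h.1

/-- The unipotent elements of `B` form the normal subgroup `N`; `B ⧸ N` is the torus
`T = torusHom.range ≤ Eˣ` (the Levi quotient). -/
noncomputable def borelQuotUnipotentEquiv :
    (borel E) ⧸ (torusHom (E := E)).ker ≃* (torusHom (E := E)).range :=
  QuotientGroup.quotientKerEquivRange _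

/-! ## 4. The unipotent radical of `B_a ≤ U(J_a)` is `N_a = ker leviHom` -/

/-- For `g ∈ B_a`: `g ∈ N_a ↔ g₀₀ = 1 ∧ g₁₁ = 1`. -/
theorem mem_ker_leviHom_iff_entries {a : E} (ha0 : a ≠ 0) (g : borelJ a ha0) :
    g ∈ (leviHom a ha0).ker ↔
      entry (g : unitaryJ a) 0 0 = 1 ∧ entry (g : unitaryJ a) 1 1 = 1 := by
  rw [MonoidHom.mem_ker, leviHom_eq_one_iff]

/-- For an upper triangular `g ∈ U(J_a)`, `g₀₀ = 1 ↔ g₂₂ = 1` (the relation `ᾱ δ = 1`). -/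
theorem entryJ_00_eq_one_iff {a : E} (g : unitaryJ a) (hg : IsUpper g) :
    entry g 0 0 = 1 ↔ entry g 2 2 = 1 := by
  have hrel := (upper_relations g hg).1
  constructor
  · intro h; rw [h, star_one, one_mul] at hrel; exact hrel
  · intro h
    rw [h, mul_one] at hrel
    have : star (star (entry g 0 0)) = star (1 : E) := by rw [hrel]
    simpa using this

/-- **The unipotent radical of `B_a = borelJ a`**: an element of the Borel of `U(J_a)` lies in
`N_a = ker leviHom` (the Heisenberg subgroup of the `n(y, z)`, files 24/26) iff its matrix is
unipotent. -/
theorem mem_ker_leviHom_iff_isUnipotent {a : E} (ha0 : a ≠ 0) (g : borelJ a ha0) :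
    g ∈ (leviHom a ha0).ker ↔ IsUnipotent₃ (mat ((g : unitaryJ a) : GL (Fin 3) E)) := by
  have hg : IsUpper (g : unitaryJ a) := (mem_borelJ_iff ha0 _).mp g.2
  rw [mem_ker_leviHom_iff_entries, mat_eq_upper _ hg, isUnipotent₃_upper_iff]
  constructor
  · rintro ⟨h0, h1⟩; exact ⟨h0, h1, (entryJ_00_eq_one_iff _ hg).mp h0⟩
  · rintro ⟨h0, h1, -⟩; exact ⟨h0, h1⟩

/-- The unipotent elements of `B_a` form the normal subgroup `N_a`; `B_a ⧸ N_a` is the Levi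
`(leviHom a ha0).range ≤ Eˣ × Eˣ` (the torus times the norm-one group `U(1)`). -/
noncomputable def borelJQuotHeisEquiv {a : E} (ha0 : a ≠ 0) :
    (borelJ a ha0) ⧸ (leviHom a ha0).ker ≃* (leviHom a ha0).range :=
  QuotientGroup.quotientKerEquivRange _

/-! ## 5. Sanity instances: the generators are unipotent -/

omit [StarRing E] in
/-- `u(x)` is unipotent. -/
theorem isUnipotent₂_unip (x : E) : IsUnipotent₂ (unip x) := by
  rw [show (unip x : Matrix (Fin 2) (Fin 2) E) = !![1, x; 0, 1] from rfl, isUnipotent₂_upper_iff]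
  exact ⟨rfl, rfl⟩

/-- `n(y, z)` is unipotent. -/
theorem isUnipotent₃_heis (a y z : E) : IsUnipotent₃ (heis a y z) := by
  rw [show (heis a y z : Matrix (Fin 3) (Fin 3) E) = !![1, -(a * star y), z; 0, 1, y; 0, 0, 1]
    from rfl, isUnipotent₃_upper_iff]
  exact ⟨rfl, rfl, rfl⟩

/-- `d(t)` is unipotent only for `t = 1`: the torus meets `N` trivially. -/
theorem isUnipotent₂_diag_iff (t : E) (ht : t ≠ 0) :
    IsUnipotent₂ (mat (T5UnipotentCommutator.diagUnit t ht)) ↔ t = 1 := by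
  rw [T5UnipotentCommutator.diagUnit_val,
    show (T5UnipotentCommutator.diag t : Matrix (Fin 2) (Fin 2) E) = !![t, 0; 0, (star t)⁻¹]
      from rfl, isUnipotent₂_upper_iff]
  constructor
  · exact fun h => h.1
  · rintro rfl; simp

/-- `d(t)` is unipotent in `U(J_a)` only for `t = 1`. -/
theorem isUnipotent₃_diag_iff (t : E) (ht : t ≠ 0) :
    IsUnipotent₃ (mat (T5HeisenbergCommutator.diagUnit t ht)) ↔ t = 1 := by
  rw [T5HeisenbergCommutator.diagUnit_val,
    show (T5HeisenbergCommutator.diag t : Matrix (Fin 3) (Fin 3) E) =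
      !![t, 0, 0; 0, 1, 0; 0, 0, (star t)⁻¹] from rfl, isUnipotent₃_upper_iff]
  constructor
  · exact fun h => h.1
  · rintro rfl; simp

end Unitary

end Summit.Ventures.HodgeRepro2.T5UnipotentRadical
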